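import Literature.NumberTheory.EllipticCurves.Rank1Residual.X12CubeSumTransport
import Summits.BirchSwinnertonDyer.Rank1Residual.X12.FrobeniusIrrRecords
import Summits.BirchSwinnertonDyer.Rank1Residual.X12.InertCoreInstancesA
import Summits.BirchSwinnertonDyer.Rank1Residual.X12.InertCoreInstancesB
import Summits.BirchSwinnertonDyer.Rank1Residual.X12.InertCoreInstancesF
import Summits.BirchSwinnertonDyer.Rank1Residual.X12.InertCoreInstancesG
import Summits.BirchSwinnertonDyer.Rank1Residual.X12.JZeroThreeRecordsA
import Summits.BirchSwinnertonDyer.Rank1Residual.X12.JZeroThreeRecordsB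
import Summits.BirchSwinnertonDyer.Rank1Residual.X12.JZeroThreeRecordsD
import Summits.BirchSwinnertonDyer.Rank1Residual.X12.JZeroThreeRecordsF
import Summits.BirchSwinnertonDyer.Rank1Residual.X12.JZeroThreeRecordsG
import Summits.BirchSwinnertonDyer.Rank1Residual.X12.JZeroThreeRecordsJ
import Summits.BirchSwinnertonDyer.Rank1Residual.X12.JZeroThreeRecordsK
import Summits.BirchSwinnertonDyer.BirchSwinnertonDyer.Theorems.PrintCFramTCubeGlobalDefectCard
import HarnessLib

/-!
# Route PrintCFram, regime T: `d₀ = #W(K)[3^∞] = 3` BY NAME for the 26 window T_cube classes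
# (cell `bsd-print-cfram`, seat p4 g3; display, supports stmt-BirchSwinnertonDyer-20699)

HONEST FRAMING (cell `bsd-print-cfram`, run/shared/lean/pub/bsd-print-cfram/, D-0131 (2) print
tier; verbatim in every file of the seat): the cell works the partition leaf
`CornerF ∧ p ramified in the CM field K` (LADDER-BSD row K7r = B13; W-ALL row 12r) in PARTITION
currency — a leaf or a cell counts only when its theorem is in the kernel BY NAME. Nothing is
closed here. INSTANCES of the seat's class-wide theorem `GlobalDefect.card_threePrimary_frameField_eq_three`
(`PrintCFramTCubeGlobalDefectCard.lean`): for the displayed member `W` (tree model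
`X12.Records.c<label>` / `X12CubeSum.cremona<label>`) of each of the 26 regime-T_cube classes of the
window `N < 2·10⁴` (census j284048 / j285547) and EVERY `3`-frame field `K` (`[K:ℚ] = 2`, `d_K = −3`):
`Nat.card (W(K)[3^∞]) = 3` — ty3 PART H's `d0 = 3`, planner ask «T_cube global-defect witnesses»
(INBOX 18:30:52Z) — with the three per-class inputs decided in the kernel: the Mordell datum
`C • W = y² = x³ + k`, the cube-sum witness (`k = c²` or `−3k = c²`), and `4k ∉ ℚ³` from one displayed
prime `p` with `3 ∤ v_p(4k)` (`not_exists_rat_cube_of_pow_dvd`). Records; nothing asserted about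
`L`-values or Selmer groups. beyond-print: NO.
-/

set_option linter.dupNamespace false
set_option autoImplicit false

noncomputable section

open scoped Classical
open WeierstrassCurve Literature.NumberTheory.EllipticCurves
  Literature.NumberTheory.EllipticCurves.Rank1Residual
  Literature.NumberTheory.EllipticCurves.HuShuYin2019
  Summit.BirchSwinnertonDyer.Rank1Residual Summit.BirchSwinnertonDyer.Rank1Residual.X12

namespace Summit.BirchSwinnertonDyer.BirchSwinnertonDyer.Theorems.PrintCFram.GlobalDefect

/-! ### `243a1` (class 243a; `k = -48`, −3k = 12²; `3^1 ∥ 4k`) -/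

/-- Mordell datum of `243a1`: `C • W = y² = x³ + -48`. [folklore] -/
theorem d0_243a1_mordell : halfScale • X12.Records.c243a1 = mordellCurve (-48 : ℚ) := by
  simp only [X12.Records.c243a1, halfScale_smul, mordellCurve]; norm_num

/-- **`d₀(243a1) = #W(K)[3^∞] = 3`** for every `3`-frame field `K` (cube-sum class 243a).
[cite: SilvermanAEC2009, Exercise 3.7 and III.10] -/
theorem d0_243a1 {K : Type} [Field K] [NumberField K] (hK2 : Module.finrank ℚ K = 2)
    (hdK : NumberField.discr K = -3) :
    Nat.card (AddCommGroup.primaryComponent ((X12.Records.c243a1).baseChange K).toAffine.Point 3) = 3 :=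
  card_threePrimary_frameField_eq_three hK2 hdK (by norm_num) d0_243a1_mordell
    (by
      haveI : Fact (Nat.Prime 3) := ⟨by norm_num⟩
      have h := not_exists_rat_cube_of_pow_dvd 3 (m := 4 * -48) (a := 1)
        (by decide) (by decide) (by decide)
      norm_num at h ⊢
      exact h)
    (Or.inr ⟨12, by norm_num⟩)

/-! ### `441b1` (class 441b; `k = 784`, k = 28²; `7^2 ∥ 4k`) -/

/-- Mordell datum of `441b1`: `C • W = y² = x³ + 784`. [folklore] -/
theorem d0_441b1_mordell : halfScale • X12CubeSum.cremona441b1 = mordellCurve (784 : ℚ) := by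
  simp only [X12CubeSum.cremona441b1, halfScale_smul, mordellCurve]; norm_num

/-- **`d₀(441b1) = #W(K)[3^∞] = 3`** for every `3`-frame field `K` (cube-sum class 441b).
[cite: SilvermanAEC2009, Exercise 3.7 and III.10] -/
theorem d0_441b1 {K : Type} [Field K] [NumberField K] (hK2 : Module.finrank ℚ K = 2)
    (hdK : NumberField.discr K = -3) :
    Nat.card (AddCommGroup.primaryComponent ((X12CubeSum.cremona441b1).baseChange K).toAffine.Point 3) = 3 :=
  card_threePrimary_frameField_eq_three hK2 hdK (by norm_num) d0_441b1_mordell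
    (by
      haveI : Fact (Nat.Prime 7) := ⟨by norm_num⟩
      have h := not_exists_rat_cube_of_pow_dvd 7 (m := 4 * 784) (a := 2)
        (by decide) (by decide) (by decide)
      norm_num at h ⊢
      exact h)
    (Or.inl ⟨28, by norm_num⟩)

/-! ### `900c1` (class 900c; `k = 100`, k = 10²; `2^4 ∥ 4k`) -/

/-- Mordell datum of `900c1`: `C • W = y² = x³ + 100`. [folklore] -/
theorem d0_900c1_mordell : (1 : VariableChange ℚ) • X12.Records.c900c1 = mordellCurve (100 : ℚ) := by
  norm_num [one_smul, X12.Records.c900c1, mordellCurve]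

/-- **`d₀(900c1) = #W(K)[3^∞] = 3`** for every `3`-frame field `K` (cube-sum class 900c).
[cite: SilvermanAEC2009, Exercise 3.7 and III.10] -/
theorem d0_900c1 {K : Type} [Field K] [NumberField K] (hK2 : Module.finrank ℚ K = 2)
    (hdK : NumberField.discr K = -3) :
    Nat.card (AddCommGroup.primaryComponent ((X12.Records.c900c1).baseChange K).toAffine.Point 3) = 3 :=
  card_threePrimary_frameField_eq_three hK2 hdK (by norm_num) d0_900c1_mordell
    (by
      haveI : Fact (Nat.Prime 2) := ⟨by norm_num⟩
      have h := not_exists_rat_cube_of_pow_dvd 2 (m := 4 * 100) (a := 4)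
        (by decide) (by decide) (by decide)
      norm_num at h ⊢
      exact h)
    (Or.inl ⟨10, by norm_num⟩)

/-! ### `972c1` (class 972c; `k = 9`, k = 3²; `2^2 ∥ 4k`) -/

/-- Mordell datum of `972c1`: `C • W = y² = x³ + 9`. [folklore] -/
theorem d0_972c1_mordell : (1 : VariableChange ℚ) • X12.Records.c972c1 = mordellCurve (9 : ℚ) := by
  norm_num [one_smul, X12.Records.c972c1, mordellCurve]

/-- **`d₀(972c1) = #W(K)[3^∞] = 3`** for every `3`-frame field `K` (cube-sum class 972c).
[cite: SilvermanAEC2009, Exercise 3.7 and III.10] -/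
theorem d0_972c1 {K : Type} [Field K] [NumberField K] (hK2 : Module.finrank ℚ K = 2)
    (hdK : NumberField.discr K = -3) :
    Nat.card (AddCommGroup.primaryComponent ((X12.Records.c972c1).baseChange K).toAffine.Point 3) = 3 :=
  card_threePrimary_frameField_eq_three hK2 hdK (by norm_num) d0_972c1_mordell
    (by
      haveI : Fact (Nat.Prime 2) := ⟨by norm_num⟩
      have h := not_exists_rat_cube_of_pow_dvd 2 (m := 4 * 9) (a := 2)
        (by decide) (by decide) (by decide)
      norm_num at h ⊢
      exact h)
    (Or.inl ⟨3, by norm_num⟩)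

/-! ### `972d1` (class 972d; `k = 36`, k = 6²; `2^4 ∥ 4k`) -/

/-- Mordell datum of `972d1`: `C • W = y² = x³ + 36`. [folklore] -/
theorem d0_972d1_mordell : (1 : VariableChange ℚ) • X12.Records.c972d1 = mordellCurve (36 : ℚ) := by
  norm_num [one_smul, X12.Records.c972d1, mordellCurve]

/-- **`d₀(972d1) = #W(K)[3^∞] = 3`** for every `3`-frame field `K` (cube-sum class 972d).
[cite: SilvermanAEC2009, Exercise 3.7 and III.10] -/
theorem d0_972d1 {K : Type} [Field K] [NumberField K] (hK2 : Module.finrank ℚ K = 2)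
    (hdK : NumberField.discr K = -3) :
    Nat.card (AddCommGroup.primaryComponent ((X12.Records.c972d1).baseChange K).toAffine.Point 3) = 3 :=
  card_threePrimary_frameField_eq_three hK2 hdK (by norm_num) d0_972d1_mordell
    (by
      haveI : Fact (Nat.Prime 2) := ⟨by norm_num⟩
      have h := not_exists_rat_cube_of_pow_dvd 2 (m := 4 * 36) (a := 4)
        (by decide) (by decide) (by decide)
      norm_num at h ⊢
      exact h)
    (Or.inl ⟨6, by norm_num⟩)

/-! ### `1323a1` (class 1323a; `k = 38416`, k = 196²; `7^4 ∥ 4k`) -/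

/-- Mordell datum of `1323a1`: `C • W = y² = x³ + 38416`. [folklore] -/
theorem d0_1323a1_mordell : halfScale • X12.Records.c1323a1 = mordellCurve (38416 : ℚ) := by
  simp only [X12.Records.c1323a1, halfScale_smul, mordellCurve]; norm_num

/-- **`d₀(1323a1) = #W(K)[3^∞] = 3`** for every `3`-frame field `K` (cube-sum class 1323a).
[cite: SilvermanAEC2009, Exercise 3.7 and III.10] -/
theorem d0_1323a1 {K : Type} [Field K] [NumberField K] (hK2 : Module.finrank ℚ K = 2)
    (hdK : NumberField.discr K = -3) :
    Nat.card (AddCommGroup.primaryComponent ((X12.Records.c1323a1).baseChange K).toAffine.Point 3) = 3 :=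
  card_threePrimary_frameField_eq_three hK2 hdK (by norm_num) d0_1323a1_mordell
    (by
      haveI : Fact (Nat.Prime 7) := ⟨by norm_num⟩
      have h := not_exists_rat_cube_of_pow_dvd 7 (m := 4 * 38416) (a := 4)
        (by decide) (by decide) (by decide)
      norm_num at h ⊢
      exact h)
    (Or.inl ⟨196, by norm_num⟩)

/-! ### `1521b1` (class 1521b; `k = 456976`, k = 676²; `13^4 ∥ 4k`) -/

/-- Mordell datum of `1521b1`: `C • W = y² = x³ + 456976`. [folklore] -/
theorem d0_1521b1_mordell : halfScale • X12.Records.c1521b1 = mordellCurve (456976 : ℚ) := by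
  simp only [X12.Records.c1521b1, halfScale_smul, mordellCurve]; norm_num

/-- **`d₀(1521b1) = #W(K)[3^∞] = 3`** for every `3`-frame field `K` (cube-sum class 1521b).
[cite: SilvermanAEC2009, Exercise 3.7 and III.10] -/
theorem d0_1521b1 {K : Type} [Field K] [NumberField K] (hK2 : Module.finrank ℚ K = 2)
    (hdK : NumberField.discr K = -3) :
    Nat.card (AddCommGroup.primaryComponent ((X12.Records.c1521b1).baseChange K).toAffine.Point 3) = 3 :=
  card_threePrimary_frameField_eq_three hK2 hdK (by norm_num) d0_1521b1_mordell
    (by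
      haveI : Fact (Nat.Prime 13) := ⟨by norm_num⟩
      have h := not_exists_rat_cube_of_pow_dvd 13 (m := 4 * 456976) (a := 4)
        (by decide) (by decide) (by decide)
      norm_num at h ⊢
      exact h)
    (Or.inl ⟨676, by norm_num⟩)

/-! ### `2700h1` (class 2700h; `k = 625`, k = 25²; `2^2 ∥ 4k`) -/

/-- Mordell datum of `2700h1`: `C • W = y² = x³ + 625`. [folklore] -/
theorem d0_2700h1_mordell : (1 : VariableChange ℚ) • X12.Records.c2700h1 = mordellCurve (625 : ℚ) := by
  norm_num [one_smul, X12.Records.c2700h1, mordellCurve]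

/-- **`d₀(2700h1) = #W(K)[3^∞] = 3`** for every `3`-frame field `K` (cube-sum class 2700h).
[cite: SilvermanAEC2009, Exercise 3.7 and III.10] -/
theorem d0_2700h1 {K : Type} [Field K] [NumberField K] (hK2 : Module.finrank ℚ K = 2)
    (hdK : NumberField.discr K = -3) :
    Nat.card (AddCommGroup.primaryComponent ((X12.Records.c2700h1).baseChange K).toAffine.Point 3) = 3 :=
  card_threePrimary_frameField_eq_three hK2 hdK (by norm_num) d0_2700h1_mordell
    (by
      haveI : Fact (Nat.Prime 2) := ⟨by norm_num⟩
      have h := not_exists_rat_cube_of_pow_dvd 2 (m := 4 * 625) (a := 2)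
        (by decide) (by decide) (by decide)
      norm_num at h ⊢
      exact h)
    (Or.inl ⟨25, by norm_num⟩)

/-! ### `4356b1` (class 4356b; `k = 58564`, k = 242²; `2^4 ∥ 4k`) -/

/-- Mordell datum of `4356b1`: `C • W = y² = x³ + 58564`. [folklore] -/
theorem d0_4356b1_mordell : (1 : VariableChange ℚ) • X12.Records.c4356b1 = mordellCurve (58564 : ℚ) := by
  norm_num [one_smul, X12.Records.c4356b1, mordellCurve]

/-- **`d₀(4356b1) = #W(K)[3^∞] = 3`** for every `3`-frame field `K` (cube-sum class 4356b).
[cite: SilvermanAEC2009, Exercise 3.7 and III.10] -/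
theorem d0_4356b1 {K : Type} [Field K] [NumberField K] (hK2 : Module.finrank ℚ K = 2)
    (hdK : NumberField.discr K = -3) :
    Nat.card (AddCommGroup.primaryComponent ((X12.Records.c4356b1).baseChange K).toAffine.Point 3) = 3 :=
  card_threePrimary_frameField_eq_three hK2 hdK (by norm_num) d0_4356b1_mordell
    (by
      haveI : Fact (Nat.Prime 2) := ⟨by norm_num⟩
      have h := not_exists_rat_cube_of_pow_dvd 2 (m := 4 * 58564) (a := 4)
        (by decide) (by decide) (by decide)
      norm_num at h ⊢
      exact h)
    (Or.inl ⟨242, by norm_num⟩)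

/-! ### `4563b1` (class 4563b; `k = 2704`, k = 52²; `13^2 ∥ 4k`) -/

/-- Mordell datum of `4563b1`: `C • W = y² = x³ + 2704`. [folklore] -/
theorem d0_4563b1_mordell : halfScale • X12CubeSum.cremona4563b1 = mordellCurve (2704 : ℚ) := by
  simp only [X12CubeSum.cremona4563b1, halfScale_smul, mordellCurve]; norm_num

/-- **`d₀(4563b1) = #W(K)[3^∞] = 3`** for every `3`-frame field `K` (cube-sum class 4563b).
[cite: SilvermanAEC2009, Exercise 3.7 and III.10] -/
theorem d0_4563b1 {K : Type} [Field K] [NumberField K] (hK2 : Module.finrank ℚ K = 2)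
    (hdK : NumberField.discr K = -3) :
    Nat.card (AddCommGroup.primaryComponent ((X12CubeSum.cremona4563b1).baseChange K).toAffine.Point 3) = 3 :=
  card_threePrimary_frameField_eq_three hK2 hdK (by norm_num) d0_4563b1_mordell
    (by
      haveI : Fact (Nat.Prime 13) := ⟨by norm_num⟩
      have h := not_exists_rat_cube_of_pow_dvd 13 (m := 4 * 2704) (a := 2)
        (by decide) (by decide) (by decide)
      norm_num at h ⊢
      exact h)
    (Or.inl ⟨52, by norm_num⟩)

/-! ### `5292h1` (class 5292h; `k = 196`, k = 14²; `2^4 ∥ 4k`) -/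

/-- Mordell datum of `5292h1`: `C • W = y² = x³ + 196`. [folklore] -/
theorem d0_5292h1_mordell : (1 : VariableChange ℚ) • X12.Records.c5292h1 = mordellCurve (196 : ℚ) := by
  norm_num [one_smul, X12.Records.c5292h1, mordellCurve]

/-- **`d₀(5292h1) = #W(K)[3^∞] = 3`** for every `3`-frame field `K` (cube-sum class 5292h).
[cite: SilvermanAEC2009, Exercise 3.7 and III.10] -/
theorem d0_5292h1 {K : Type} [Field K] [NumberField K] (hK2 : Module.finrank ℚ K = 2)
    (hdK : NumberField.discr K = -3) :
    Nat.card (AddCommGroup.primaryComponent ((X12.Records.c5292h1).baseChange K).toAffine.Point 3) = 3 :=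
  card_threePrimary_frameField_eq_three hK2 hdK (by norm_num) d0_5292h1_mordell
    (by
      haveI : Fact (Nat.Prime 2) := ⟨by norm_num⟩
      have h := not_exists_rat_cube_of_pow_dvd 2 (m := 4 * 196) (a := 4)
        (by decide) (by decide) (by decide)
      norm_num at h ⊢
      exact h)
    (Or.inl ⟨14, by norm_num⟩)

/-! ### `5292i1` (class 5292i; `k = 2401`, k = 49²; `2^2 ∥ 4k`) -/

/-- Mordell datum of `5292i1`: `C • W = y² = x³ + 2401`. [folklore] -/
theorem d0_5292i1_mordell : (1 : VariableChange ℚ) • X12.Records.c5292i1 = mordellCurve (2401 : ℚ) := by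
  norm_num [one_smul, X12.Records.c5292i1, mordellCurve]

/-- **`d₀(5292i1) = #W(K)[3^∞] = 3`** for every `3`-frame field `K` (cube-sum class 5292i).
[cite: SilvermanAEC2009, Exercise 3.7 and III.10] -/
theorem d0_5292i1 {K : Type} [Field K] [NumberField K] (hK2 : Module.finrank ℚ K = 2)
    (hdK : NumberField.discr K = -3) :
    Nat.card (AddCommGroup.primaryComponent ((X12.Records.c5292i1).baseChange K).toAffine.Point 3) = 3 :=
  card_threePrimary_frameField_eq_three hK2 hdK (by norm_num) d0_5292i1_mordell
    (by
      haveI : Fact (Nat.Prime 2) := ⟨by norm_num⟩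
      have h := not_exists_rat_cube_of_pow_dvd 2 (m := 4 * 2401) (a := 2)
        (by decide) (by decide) (by decide)
      norm_num at h ⊢
      exact h)
    (Or.inl ⟨49, by norm_num⟩)

/-! ### `6075bc1` (class 6075bc; `k = 3600`, k = 60²; `3^2 ∥ 4k`) -/

/-- Mordell datum of `6075bc1`: `C • W = y² = x³ + 3600`. [folklore] -/
theorem d0_6075bc1_mordell : halfScale • X12.Records.c6075bc1 = mordellCurve (3600 : ℚ) := by
  simp only [X12.Records.c6075bc1, halfScale_smul, mordellCurve]; norm_num

/-- **`d₀(6075bc1) = #W(K)[3^∞] = 3`** for every `3`-frame field `K` (cube-sum class 6075bc).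
[cite: SilvermanAEC2009, Exercise 3.7 and III.10] -/
theorem d0_6075bc1 {K : Type} [Field K] [NumberField K] (hK2 : Module.finrank ℚ K = 2)
    (hdK : NumberField.discr K = -3) :
    Nat.card (AddCommGroup.primaryComponent ((X12.Records.c6075bc1).baseChange K).toAffine.Point 3) = 3 :=
  card_threePrimary_frameField_eq_three hK2 hdK (by norm_num) d0_6075bc1_mordell
    (by
      haveI : Fact (Nat.Prime 3) := ⟨by norm_num⟩
      have h := not_exists_rat_cube_of_pow_dvd 3 (m := 4 * 3600) (a := 2)
        (by decide) (by decide) (by decide)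
      norm_num at h ⊢
      exact h)
    (Or.inl ⟨60, by norm_num⟩)

end Summit.BirchSwinnertonDyer.BirchSwinnertonDyer.Theorems.PrintCFram.GlobalDefect

end
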